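import Mathlib.RingTheory.Localization.FractionRing
import Literature.Computability.AlgebraicComplexity.RankOneDeterminantalExpressionsProofs
import Literature.Computability.AlgebraicComplexity.VonZurGathenRegularity
import Literature.Computability.AlgebraicComplexity.LandsbergRessayreNormalForm

/-!
# `UlrichPadded.RankOneTrivialisation` (stmt-ValiantsHypothesis-5667),
# line `nagata-multilinear-chart`: the `2 × 2` minors of the adjugate of a singular matrix
# over a domain vanish

Pure linear algebra (no permanent anywhere).  For a square matrix `B` over a DOMAIN `S` with
`det B = 0`, every `2 × 2` minor of `adj B` vanishes:
`adj B i j * adj B k l = adj B i l * adj B k j`.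

Proof.  Over a FIELD `K` the adjugate of a singular matrix is an outer product `c wᵀ`
(`adjugate_eq_vecMulVec_of_det_eq_zero`): if `rank N ≤ m - 2` then `adj N = 0`
(`VonZurGathen.adjugate_eq_zero_of_rank_lt`), and if `rank N = m - 1` the columns of `adj N` lie
in the one-dimensional kernel of `N` (`N · adj N = det N • 1 = 0`, rank–nullity), so
`rank (adj N) ≤ 1` and `exists_vecMulVec_of_rank_le_one` applies; the minor identity for an outer
product is `ring`.  Over a domain `S`, push `B` along the injective `algebraMap S (FractionRing S)`,
which commutes with `det` and `adj` (`RingHom.map_det`, `RingHom.map_adjugate`), and pull the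
identity back by injectivity (`IsFractionRing.injective`).

This is hypothesis `h2x2` of the lead's composition `rankOneTrivialisation_of_parts`.
-/

noncomputable section

namespace Summit.ValiantsHypothesis.Theorems.RankOneTrivialisation

open Matrix
open Literature.Computability.AlgebraicComplexity

-- adapted from Cruxes/RankOneTrivialisation/Lines/corank-one-pencil.lean
/-- **Linear algebra over a field.** The adjugate of a singular square matrix over a field is an
outer product: if `rank N ≤ m - 2` then `adj N = 0`, and if `rank N = m - 1` the columns of
`adj N` lie in the one-dimensional kernel of `N` (`N · adj N = det N • 1 = 0`). [folklore] -/
theorem adjugate_eq_vecMulVec_of_det_eq_zero {K : Type*} [Field K] {m : ℕ}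
    (N : Matrix (Fin m) (Fin m) K) (hN : N.det = 0) :
    ∃ c w : Fin m → K, N.adjugate = Matrix.vecMulVec c w := by
  apply exists_vecMulVec_of_rank_le_one
  by_cases hlt : N.rank + 1 < m
  · rw [VonZurGathen.adjugate_eq_zero_of_rank_lt hlt, Matrix.rank_zero]
    exact zero_le_one
  · -- `rank N = m - 1`: the range of `adj N` sits inside `ker N`, which is a line
    have hrk : N.rank < m := by
      have := Matrix.rank_lt_card_of_det_eq_zero hN
      rwa [Fintype.card_fin] at this
    have hle : LinearMap.range N.adjugate.mulVecLin ≤ LinearMap.ker N.mulVecLin := by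
      rintro _ ⟨v, rfl⟩
      rw [LinearMap.mem_ker, Matrix.mulVecLin_apply, Matrix.mulVecLin_apply, Matrix.mulVec_mulVec,
        Matrix.mul_adjugate, hN, zero_smul, Matrix.zero_mulVec]
    have hker : Module.finrank K (LinearMap.ker N.mulVecLin) + N.rank = m := by
      rw [Matrix.rank, add_comm]
      have := LinearMap.finrank_range_add_finrank_ker N.mulVecLin
      rwa [Module.finrank_fintype_fun_eq_card, Fintype.card_fin] at this
    calc N.adjugate.rank = Module.finrank K (LinearMap.range N.adjugate.mulVecLin) := rfl
      _ ≤ Module.finrank K (LinearMap.ker N.mulVecLin) := Submodule.finrank_mono hle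
      _ ≤ 1 := by omega

/-- **The `2 × 2` minors of the adjugate of a singular matrix over a field vanish** (immediate from
the outer-product form `adj N = c wᵀ`). [folklore] -/
theorem adjugate_twoByTwo_of_det_eq_zero_field {K : Type*} [Field K] {m : ℕ}
    (N : Matrix (Fin m) (Fin m) K) (hN : N.det = 0) (i j k l : Fin m) :
    N.adjugate i j * N.adjugate k l = N.adjugate i l * N.adjugate k j := by
  obtain ⟨c, w, hcw⟩ := adjugate_eq_vecMulVec_of_det_eq_zero N hN
  simp only [hcw, Matrix.vecMulVec_apply]
  ring

/-- Adjugate commutes with entrywise ring homs (Mathlib `RingHom.map_adjugate`, `map` form).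
[folklore] -/
theorem adjugate_map {A B : Type*} [CommRing A] [CommRing B] (f : A →+* B) {m : ℕ}
    (M : Matrix (Fin m) (Fin m) A) : (M.map f).adjugate = M.adjugate.map f := by
  have h := RingHom.map_adjugate f M
  rw [RingHom.mapMatrix_apply, RingHom.mapMatrix_apply] at h
  exact h.symm

/-- **Stub `stub_adjugate_twoByTwo_of_det_eq_zero` (linear algebra over a domain).** For a square
matrix `B` over a domain `S` with `det B = 0`, every `2 × 2` minor of `adj B` vanishes:
`adj B i j * adj B k l = adj B i l * adj B k j` (the adjugate of a singular matrix has rank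
`≤ 1`).
Proof: push to the fraction field `K = Frac S` along the injective `algebraMap S K`, which commutes
with `det` and `adj`; there `adj` of the (still singular) image is an outer product. [folklore] -/
theorem stub_adjugate_twoByTwo_of_det_eq_zero :
    ∀ (S : Type) [CommRing S] [IsDomain S] (m : ℕ) (B : Matrix (Fin m) (Fin m) S),
      B.det = 0 → ∀ i j k l : Fin m,
        B.adjugate i j * B.adjugate k l = B.adjugate i l * B.adjugate k j := by
  intro S _ _ m B hdet i j k l
  set f : S →+* FractionRing S := algebraMap S (FractionRing S) with hf
  have hinj : Function.Injective f := IsFractionRing.injective S (FractionRing S)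
  have hdet' : (B.map f).det = 0 := by
    have h := RingHom.map_det f B
    rw [RingHom.mapMatrix_apply] at h
    rw [← h, hdet, map_zero]
  have key := adjugate_twoByTwo_of_det_eq_zero_field (B.map f) hdet' i j k l
  rw [adjugate_map] at key
  simp only [Matrix.map_apply] at key
  rw [← map_mul, ← map_mul] at key
  exact hinj key

end Summit.ValiantsHypothesis.Theorems.RankOneTrivialisation

end
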